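import Mathlib

/-!
# Pinned-slope certificate (part 2/3): the `A₅`-slope of the door-(a) sections of length ≤ 7

Solo residency `solo-SmoothPoincare4-informed`, session 14; algebraic core of COMPUTATION 11.38(a)
(slope `x = c + 1`; words SSTssss, SSSStts, SSTssts, SStssTS) of the residency file `paper/poincare-
sphere-trick.md` §11.9 (prose results under adjudication, not theorems of this tree). Companion of
`SoloInformedPinnedSlopeCertificate.lean` (same machinery, duplicated so that the files are
independent; the twelve words are split over three files only to respect the file-length lint).

Geometric provenance (prose + machine computation, not formalised here). `N_P = P ×_c S¹ ⊂ W = S³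
×_c S¹` is the mapping torus of complex conjugation on the `c`-invariant punctured Klein bottle `P`
bounded by the trefoil; a cyclically reduced word `w` of odd length in `π₁(P) = F⟨s,t⟩` defines a
section `γ_w ⊂ N_P`. A Dehn filling `N_P(γ_w; α)` with `π₁ ≅ ℤ` is a solid Klein bottle in `S⁴` and
yields an unknotting theorem for a Klein bottle in `S⁴`, hence the standardness of one half of a
Yoshikawa type of homotopy 4-spheres (§11 of the residency file). THEOREM 11.37 there (pseudo-Anosov
pinning) shows that only the three slopes at distance ≤ 1 from the degeneracy slope of the (pseudo-
Anosov) monodromy can give a solid Klein bottle; two of them are excluded by torsion in a 3-fold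
cover, and the third, the 'fake slope' `x_* = c + 1` (homology `ℤ`, all small cyclic covers
homology-cyclic), by an `A₅`-quotient. The presentations below — six generators `a,b,c,d,e` (free
generators of the fibre group `π₁(Σ_{1,4})`) and `y` (orientation-reversing), thirteen relators
(five `τ g τ⁻¹ = ĥ_w(g)` for the normalised monodromy `ĥ_w` and the filled stable letter `τ`, one
cusp relation, five `y g y⁻¹ = ι(g)`, `y² = ι²`, `y τ y⁻¹ = z τ`) — are the output of the residency
scripts `work/s14/fdtc.py`, `a5cert.py` for `π₁(N_P(γ_w; α_{x_*}))`, taken here as INPUT; what is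
kernel-checked is that each presented group maps to `S₅` with non-commuting generator images
(explicit images of all six generators in `A₅`, every relator verified by `decide`), hence is non-
commutative and not isomorphic to `ℤ`.
-/

set_option maxRecDepth 20000

namespace Summit.SmoothPoincare4.SmoothPoincare4.Theorems
namespace PinnedSlopeB

/-! ## Certificate machinery: six generators, relators as words, images in `S₅` -/

/-- A word in six generators: list of (generator, `true` = generator / `false` = inverse). -/
abbrev W : Type := List (Fin 6 × Bool)

/-- generator `a` -/ abbrev a : Fin 6 × Bool := (0, true)
/-- inverse of `a` -/ abbrev A : Fin 6 × Bool := (0, false)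
/-- generator `b` -/ abbrev b : Fin 6 × Bool := (1, true)
/-- inverse of `b` -/ abbrev B : Fin 6 × Bool := (1, false)
/-- generator `c` -/ abbrev c : Fin 6 × Bool := (2, true)
/-- inverse of `c` -/ abbrev C : Fin 6 × Bool := (2, false)
/-- generator `d` -/ abbrev d : Fin 6 × Bool := (3, true)
/-- inverse of `d` -/ abbrev D : Fin 6 × Bool := (3, false)
/-- generator `e` -/ abbrev e : Fin 6 × Bool := (4, true)
/-- inverse of `e` -/ abbrev E : Fin 6 × Bool := (4, false)
/-- generator `y` -/ abbrev y : Fin 6 × Bool := (5, true)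
/-- inverse of `y` -/ abbrev Y : Fin 6 × Bool := (5, false)

/-- Evaluate a word on a choice of six permutations. -/
def evalP (f : Fin 6 → Equiv.Perm (Fin 5)) (L : W) : Equiv.Perm (Fin 5) :=
  (L.map fun x => cond x.2 (f x.1) (f x.1)⁻¹).prod

/-- The relator set of a list of words. -/
def relSet (R : List W) : Set (FreeGroup (Fin 6)) := {g | ∃ L ∈ R, FreeGroup.mk L = g}

/-- The finitely presented group `⟨a₁,…,a₅,y ∣ R⟩`. -/
abbrev G (R : List W) : Type := PresentedGroup (relSet R)

/-- A homomorphism `G R → S₅` from six permutations satisfying the relators. -/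
def toPerm (R : List W) (f : Fin 6 → Equiv.Perm (Fin 5)) (h : ∀ L ∈ R, evalP f L = 1) :
    G R →* Equiv.Perm (Fin 5) :=
  PresentedGroup.toGroup (f := f) (by
    rintro r ⟨L, hL, rfl⟩
    rw [FreeGroup.lift_mk]
    exact h L hL)

/-- `toPerm` on generators. -/
@[simp] theorem toPerm_of (R : List W) (f : Fin 6 → Equiv.Perm (Fin 5)) (h : ∀ L ∈ R, evalP f L = 1)
    (i : Fin 6) : toPerm R f h (PresentedGroup.of i) = f i := by
  simp [toPerm]

/-- If two generator images do not commute, the presented group is not commutative … -/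
theorem of_mul_of_ne (R : List W) (f : Fin 6 → Equiv.Perm (Fin 5)) (h : ∀ L ∈ R, evalP f L = 1)
    (i j : Fin 6) (hij : f i * f j ≠ f j * f i) :
    (PresentedGroup.of i : G R) * PresentedGroup.of j ≠
      PresentedGroup.of j * PresentedGroup.of i := by
  intro hc
  have := congrArg (toPerm R f h) hc
  simp only [map_mul, toPerm_of] at this
  exact hij this

/-- … and in particular not isomorphic to `ℤ`. -/
theorem isEmpty_mulEquiv_int (R : List W) (f : Fin 6 → Equiv.Perm (Fin 5))
    (h : ∀ L ∈ R, evalP f L = 1)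
    (i j : Fin 6) (hij : f i * f j ≠ f j * f i) : IsEmpty (G R ≃* Multiplicative ℤ) := by
  refine ⟨fun q => of_mul_of_ne R f h i j hij ?_⟩
  apply q.injective
  rw [map_mul, map_mul, mul_comm]


/-! ## The fake-slope filling groups -/

/-- Relators of `π₁(N_P(γ_w; α_{c+1}))`, `w = SSTssss` (`|ĥ_w| = 218`). -/
def R_SSTssss : List W :=
  [[A, b, a, E, B, a, E, D, e, c, D, e, B, a, E, B, d, e, A, b, e, A, b, E, B, a, E, D, e, c, D,
     E, d, C, E, d, e, A, b, e],
   [A, b, a, E, B, a, E, D, e, c, D, e, B, a, E, B, d, e, A, b, e, A, b, E, B, a, E, D, e, c, D,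
     E, d, C, E, d, e, A, b, e],
   [A, b, c, B, a, E, B, a, E, D, e, c, D, e, B, a, E, B, e, c, D, e, d, C, E, d, C, E, b, e, A,
     b, e, B, a, E, B, d, e, A, b, e, A, b, E, B, a, E, D, e, c, D, E, d, C, E, d, e, A, b, e],
   [A, b, d, B, a, E, B, a, E, D, e, c, D, e, e, B, a, E, B, d, e, A, b, e, A, b, E, B, a, E, D,
     e, c, D, E, d, C, E, d, e, A, b, e],
   [A, b, e, B, a, E, B, a, E, D, e, c, D, e, d, C, E, d, B, e, c, D, e, c, D, E, d, C, E, d, e,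
     A, b, e, A, b, E, B, a, E, D, e, c, D, E, d, C, E, d, e, A, b, e],
   [E, d, C, E, b, e, A, b, e, B, a, E, B, d, e, A, b, e, A, b, E, B, a, E, D, e, c, D, E, d, C,
     E, d, e, A, b, e, A, b, d, C],
   [y, a, Y, c, E],
   [y, b, Y, d, E],
   [y, c, Y, a, E],
   [y, d, Y, b, E],
   [y, e, Y, E],
   [y, y, E],
   [y, A, b, Y, B, a, E, B, a, E, D, e, c, D, e, d, C, E, d, e, A, b, e, B, a, E, B, a, E, D, b,
     e, A, b, E, B, a, E, B, e, c, D, e]]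

/-- Generator images in `A₅` for `w = SSTssss`. -/
def f_SSTssss : Fin 6 → Equiv.Perm (Fin 5) :=
  ![Equiv.swap 0 2 * Equiv.swap 2 1,
    Equiv.swap 2 3 * Equiv.swap 3 4,
    Equiv.swap 0 1 * Equiv.swap 1 2 * Equiv.swap 2 3 * Equiv.swap 3 4,
    Equiv.swap 0 2 * Equiv.swap 2 4 * Equiv.swap 4 3 * Equiv.swap 3 1,
    Equiv.swap 0 1 * Equiv.swap 1 2 * Equiv.swap 2 4 * Equiv.swap 4 3,
    Equiv.swap 0 4 * Equiv.swap 4 1 * Equiv.swap 1 3 * Equiv.swap 3 2]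

/-- Every relator of `R_SSTssss` holds for `f_SSTssss`. -/
theorem rels_SSTssss : ∀ L ∈ R_SSTssss, evalP f_SSTssss L = 1 := by decide

/-- Two generator images do not commute. -/
theorem nc_SSTssss : f_SSTssss 2 * f_SSTssss 3 ≠ f_SSTssss 3 * f_SSTssss 2 := by decide

/-- MAIN (SSTssss): the fake-slope filling group of `γ_w`, `w = SSTssss`, is not `ℤ`. -/
theorem isEmpty_G_SSTssss_mulEquiv_int : IsEmpty (G R_SSTssss ≃* Multiplicative ℤ) :=
  isEmpty_mulEquiv_int R_SSTssss f_SSTssss rels_SSTssss 2 3 nc_SSTssss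

/-- Relators of `π₁(N_P(γ_w; α_{c+1}))`, `w = SSSStts` (`|ĥ_w| = 242`). -/
def R_SSSStts : List W :=
  [[A, b, a, E, d, B, e, c, D, D, b, d, C, B, d, e, A, b, c, D, B, e, B, a, E, d, C, E, b, D, e,
     A, b, E, d, B, e, B, a, E, d, C, E, b, D, e],
   [A, b, a, E, d, B, e, c, D, D, b, d, C, B, d, e, A, b, c, D, B, e, B, a, E, d, C, E, b, D, e,
     A, b, E, d, B, e, B, a, E, d, C, E, b, D, e],
   [A, b, c, B, a, E, d, B, e, c, D, D, b, d, C, B, d, e, A, b, c, D, D, b, d, C, B, d, e, A, b,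
     c, D, B, e, B, a, E, d, C, E, b, D, e, A, b, E, d, B, e, B, a, E, d, C, E, b, D, e],
   [A, b, d, B, a, E, d, B, e, c, D, e, A, b, c, D, D, b, d, C, B, d, e, A, b, c, D, B, e, B, a,
     E, d, C, E, b, D, e, A, b, E, d, B, e, B, a, E, d, C, E, b, D, e],
   [A, b, e, B, a, E, d, B, e, c, D, e, A, b, E, b, D, e, B, a, E, d, B, e, c, D, e, A, b, E, d,
     B, e, B, a, E, d, C, E, b, D, e, A, b, E, d, B, e, B, a, E, d, C, E, b, D, e],
   [B, d, e, A, b, c, D, D, b, d, C, B, d, e, A, b, c, D, B, e, B, a, E, d, C, E, b, D, e, A, b,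
     E, d, B, e, B, a, E, d, C, E, b, D, e, A, b, d, C],
   [y, a, Y, c, E],
   [y, b, Y, d, E],
   [y, c, Y, a, E],
   [y, d, Y, b, E],
   [y, e, Y, E],
   [y, y, E],
   [y, A, b, Y, B, a, E, d, B, e, c, D, e, A, b, E, b, D, e, B, a, E, d, B, e, c, D, e, A, b, E,
     b, d, C, B, a, E, D, b, c, D, B, d, d, C, B, a, E, D, b]]

/-- Generator images in `A₅` for `w = SSSStts`. -/
def f_SSSStts : Fin 6 → Equiv.Perm (Fin 5) :=
  ![Equiv.swap 0 1 * Equiv.swap 3 4,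
    Equiv.swap 0 3 * Equiv.swap 3 2 * Equiv.swap 2 1 * Equiv.swap 1 4,
    Equiv.swap 0 1 * Equiv.swap 1 2 * Equiv.swap 2 3 * Equiv.swap 3 4,
    1,
    Equiv.swap 0 3 * Equiv.swap 3 2 * Equiv.swap 2 1 * Equiv.swap 1 4,
    Equiv.swap 0 1 * Equiv.swap 1 3 * Equiv.swap 3 4 * Equiv.swap 4 2]

/-- Every relator of `R_SSSStts` holds for `f_SSSStts`. -/
theorem rels_SSSStts : ∀ L ∈ R_SSSStts, evalP f_SSSStts L = 1 := by decide

/-- Two generator images do not commute. -/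
theorem nc_SSSStts : f_SSSStts 2 * f_SSSStts 5 ≠ f_SSSStts 5 * f_SSSStts 2 := by decide

/-- MAIN (SSSStts): the fake-slope filling group of `γ_w`, `w = SSSStts`, is not `ℤ`. -/
theorem isEmpty_G_SSSStts_mulEquiv_int : IsEmpty (G R_SSSStts ≃* Multiplicative ℤ) :=
  isEmpty_mulEquiv_int R_SSSStts f_SSSStts rels_SSSStts 2 5 nc_SSSStts

/-- Relators of `π₁(N_P(γ_w; α_{c+1}))`, `w = SSTssts` (`|ĥ_w| = 396`). -/
def R_SSTssts : List W :=
  [[A, b, a, E, d, d, C, B, a, E, D, b, c, D, B, e, c, D, D, e, B, a, E, d, d, C, B, d, e, A, b,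
     c, D, D, e, A, b, E, d, d, C, B, a, E, D, b, c, D, B, e, B, a, E, d, C, E, b, d, C, B, d, e,
     A, b, c, D, D, e],
   [A, b, a, E, d, d, C, B, a, E, D, b, c, D, B, e, c, D, D, e, B, a, E, d, d, C, B, d, e, A, b,
     c, D, D, e, A, b, E, d, d, C, B, a, E, D, b, c, D, B, e, B, a, E, d, C, E, b, d, C, B, d, e,
     A, b, c, D, D, e],
   [A, b, c, B, a, E, d, d, C, B, a, E, D, b, c, D, B, e, c, D, D, e, B, a, E, d, B, e, c, D, e,
     A, b, E, b, d, C, B, e, B, a, E, d, C, E, b, D, e, A, b, E, d, e, A, b, c, D, D, e, B, a, E,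
     d, d, C, B, d, e, A, b, c, D, D, e, A, b, E, d, d, C, B, a, E, D, b, c, D, B, e, B, a, E, d,
     C, E, b, d, C, B, d, e, A, b, c, D, D, e],
   [A, b, d, B, a, E, d, d, C, B, a, E, D, b, c, D, B, e, c, D, e, A, b, c, D, D, e, B, a, E, d,
     d, C, B, d, e, A, b, c, D, D, e, A, b, E, d, d, C, B, a, E, D, b, c, D, B, e, B, a, E, d, C,
     E, b, d, C, B, d, e, A, b, c, D, D, e],
   [A, b, e, B, a, E, d, d, C, B, a, E, D, b, c, D, B, e, c, D, e, A, b, E, b, d, C, B, e, B, a,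
     E, d, B, e, c, D, e, A, b, E, b, c, D, B, e, B, a, E, d, C, E, b, d, C, B, d, e, A, b, c, D,
     D, e, A, b, E, d, d, C, B, a, E, D, b, c, D, B, e, B, a, E, d, C, E, b, d, C, B, d, e, A, b,
     c, D, D, e],
   [B, e, B, a, E, d, C, E, b, D, e, A, b, E, d, e, A, b, c, D, D, e, B, a, E, d, d, C, B, d, e,
     A, b, c, D, D, e, A, b, E, d, d, C, B, a, E, D, b, c, D, B, e, B, a, E, d, C, E, b, d, C, B,
     d, e, A, b, c, D, D, e, A, b, d, C],
   [y, a, Y, c, E],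
   [y, b, Y, d, E],
   [y, c, Y, a, E],
   [y, d, Y, b, E],
   [y, e, Y, E],
   [y, y, E],
   [y, A, b, Y, B, a, E, d, d, C, B, a, E, D, b, c, D, B, e, c, D, e, A, b, E, b, d, C, B, d, e,
     A, b, c, D, D, e, B, a, E, d, d, C, B, a, E, D, b, c, D, D, e, A, b, E, d, d, C, B, a, E, D,
     e, B, a, E, d, B, e, c, D, e, A, b, E, b]]

/-- Generator images in `A₅` for `w = SSTssts`. -/
def f_SSTssts : Fin 6 → Equiv.Perm (Fin 5) :=
  ![Equiv.swap 0 2 * Equiv.swap 2 3 * Equiv.swap 3 4 * Equiv.swap 4 1,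
    Equiv.swap 0 3 * Equiv.swap 3 4 * Equiv.swap 4 1 * Equiv.swap 1 2,
    Equiv.swap 2 3 * Equiv.swap 3 4,
    Equiv.swap 1 2 * Equiv.swap 3 4,
    Equiv.swap 0 2 * Equiv.swap 2 4 * Equiv.swap 4 1 * Equiv.swap 1 3,
    Equiv.swap 0 1 * Equiv.swap 1 2 * Equiv.swap 2 3 * Equiv.swap 3 4]

/-- Every relator of `R_SSTssts` holds for `f_SSTssts`. -/
theorem rels_SSTssts : ∀ L ∈ R_SSTssts, evalP f_SSTssts L = 1 := by decide

/-- Two generator images do not commute. -/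
theorem nc_SSTssts : f_SSTssts 2 * f_SSTssts 3 ≠ f_SSTssts 3 * f_SSTssts 2 := by decide

/-- MAIN (SSTssts): the fake-slope filling group of `γ_w`, `w = SSTssts`, is not `ℤ`. -/
theorem isEmpty_G_SSTssts_mulEquiv_int : IsEmpty (G R_SSTssts ≃* Multiplicative ℤ) :=
  isEmpty_mulEquiv_int R_SSTssts f_SSTssts rels_SSTssts 2 3 nc_SSTssts

/-- Relators of `π₁(N_P(γ_w; α_{c+1}))`, `w = SStssTS` (`|ĥ_w| = 374`). -/
def R_SStssTS : List W :=
  [[A, b, a, c, D, a, E, B, a, E, d, C, e, A, e, c, B, a, E, c, D, e, A, b, C, E, d, C, e, A, e,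
     c, B, a, E, c, D, e, A, b, C, E, d, C, B, a, c, B, a, E, d, C, e, A, b, C, E, a, E, c, D, e,
     A, b, e, A, d, C],
   [A, b, a, c, D, a, E, B, a, E, d, C, e, A, e, c, B, a, E, c, D, e, A, b, C, E, d, C, e, A, e,
     c, B, a, E, c, D, e, A, b, C, E, d, C, B, a, c, B, a, E, d, C, e, A, b, C, E, a, E, c, D, e,
     A, b, e, A, d, C],
   [A, b, c, B, a, c, D, a, E, B, a, E, d, C, e, A, e, c, B, a, E, c, D, e, A, b, C, A, b, e, A,
     d, C, B, a, c, D, a, E, C, A, b, c, D, e, c, B, a, E, d, C, e, A, b, C, E, d, C, B, a, c, e,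
     A, d, C, A, b, c, D, e, c, B, a, E, c, D, e, A, b, C, E, d, C, B, a, c, B, a, E, d, C, e, A,
     b, C, E, a, E, c, D, e, A, b, e, A, d, C],
   [A, b, d, B, a, c, D, a, E, B, a, E, d, C, e, A, e, c, B, a, E, c, D, e, A, b, C, A, b, e, A,
     e, c, B, a, E, c, D, e, A, b, C, E, d, C, B, a, c, B, a, E, d, C, e, A, b, C, E, a, E, c, D,
     e, A, b, e, A, d, C],
   [A, b, e, B, a, c, D, a, E, B, a, E, d, C, e, A, e, c, B, a, E, c, D, e, A, b, e, A, d, C, A,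
     b, c, D, a, E, B, a, E, d, C, e, A, e, c, B, a, E, c, D, e, A, b, C, E, d, C, B, a, c, B, a,
     E, d, C, e, A, b, C, E, a, E, c, D, e, A, b, e, A, d, C],
   [e, A, b, C, E, d, C, B, a, c, e, A, d, C, A, b, c, D, e, c, B, a, E, c, D, e, A, b, C, E, d,
     C, B, a, c, B, a, E, d, C, e, A, b, C, E, a, E, c, D, e, A, b, e, A, d, C, A, b, d, C],
   [y, a, Y, c, E],
   [y, b, Y, d, E],
   [y, c, Y, a, E],
   [y, d, Y, b, E],
   [y, e, Y, E],
   [y, y, E],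
   [y, A, b, Y, B, a, c, D, a, E, B, a, E, d, C, e, A, e, c, B, a, E, c, D, e, A, b, C, A, b, c,
     D, e, c, B, a, E, d, C, e, A, b, C, E, d, C, B, a, c, D, a, E, C, A, b, c, D, e, c, B, a, E]]

/-- Generator images in `A₅` for `w = SStssTS`. -/
def f_SStssTS : Fin 6 → Equiv.Perm (Fin 5) :=
  ![Equiv.swap 0 3 * Equiv.swap 3 4 * Equiv.swap 4 2 * Equiv.swap 2 1,
    Equiv.swap 0 1 * Equiv.swap 3 4,
    Equiv.swap 2 3 * Equiv.swap 3 4,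
    Equiv.swap 0 1 * Equiv.swap 1 2 * Equiv.swap 2 3 * Equiv.swap 3 4,
    Equiv.swap 0 3 * Equiv.swap 3 2 * Equiv.swap 2 1 * Equiv.swap 1 4,
    Equiv.swap 0 1 * Equiv.swap 1 3 * Equiv.swap 3 4 * Equiv.swap 4 2]

/-- Every relator of `R_SStssTS` holds for `f_SStssTS`. -/
theorem rels_SStssTS : ∀ L ∈ R_SStssTS, evalP f_SStssTS L = 1 := by decide

/-- Two generator images do not commute. -/
theorem nc_SStssTS : f_SStssTS 2 * f_SStssTS 3 ≠ f_SStssTS 3 * f_SStssTS 2 := by decide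

/-- MAIN (SStssTS): the fake-slope filling group of `γ_w`, `w = SStssTS`, is not `ℤ`. -/
theorem isEmpty_G_SStssTS_mulEquiv_int : IsEmpty (G R_SStssTS ≃* Multiplicative ℤ) :=
  isEmpty_mulEquiv_int R_SStssTS f_SStssTS rels_SStssTS 2 3 nc_SStssTS
end PinnedSlopeB
end Summit.SmoothPoincare4.SmoothPoincare4.Theorems
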